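import Summits.QuantumFields.GaugeBoot.Rows.KZL2rpD4RowHA
import Summits.QuantumFields.GaugeBoot.Rows.KZL2rpD4RowHB
import Summits.QuantumFields.GaugeBoot.Rows.KZL2rpD4RowHC
import Summits.QuantumFields.GaugeBoot.Rows.KZL2rpD4RowHD
import Summits.QuantumFields.GaugeBoot.Rows.KZL2rpD4RowHE
import Summits.QuantumFields.GaugeBoot.Rows.KZL2rpD4RowRA
import Summits.QuantumFields.GaugeBoot.Rows.KZL2rpD4RowRB
import Summits.QuantumFields.GaugeBoot.Rows.KZL2rpD4RowRC
import Summits.QuantumFields.GaugeBoot.Rows.KZL2rpD4RowRD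
import Summits.QuantumFields.GaugeBoot.Rows.KZL2rpD4PairH
import Summits.QuantumFields.GaugeBoot.Rows.KZL2rpD4PairR
import HarnessLib

/-!
# Gauge-boot: transport-table accessors of the representative rows and the per-entry transport claims

Cell `pub-gaugeboot` (HOME `run/shared/lean/pub/pub-gaugeboot/`), seat lean1 (SYMMETRY-FACTORISED torus layer for the kz-L2-rp-4D family =
rows C91–C106 / C123–C127; label set, lines, irrep data, pair/row class certification, orbit tables, reduction identity, assembly).

HONEST FRAMING (page 1 of every file of this cell): certified bounds on lattice expectations at STATED coupling,
gauge group, dimension and torus size; NOT a mass gap, NOT a continuum limit, NOT a string tension, NOT large `N`.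
The venture is explicitly NOT Yang–Mills-summit-bearing (barriers `FixedCouplingUltralocality`,
`PerturbativeInvisibility`).

`rowQ{H,R} r b` (representative pair), `rowU… r b` (code), `rowSw… r b` (flag) read the flat tables; `RowHOK r b` / `RowROK r b` = the
transport claim checked by the kernel in `…RowHChk…` / `…RowRChk…`: the code is `< 768` (and fixes the time axis for the half-space rows)
and carries the representative pair to `(row line r, line b)` (transposed if the flag is set) — the hypothesis shape of `SymB4.W_rawHw_transport`.
-/

noncomputable section

open Literature.MathematicalPhysics.QuantumFieldTheory

namespace Summit.QuantumFields.GaugeBoot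

namespace KZL2rpD4

/-- Numeral `i` of the flat `rowH` table (dispatch over the data parts). -/
def rowHChunk (i : ℕ) : ℕ := if i < 345 then rowHChunkA (i - 0) else if i < 690 then rowHChunkB (i - 345) else if i < 1035 then rowHChunkC (i - 690) else if i < 1379 then rowHChunkD (i - 1035) else rowHChunkE (i - 1379)

/-- Entry `i` of the flat `rowH` table (25 bits). -/
def rowHE (i : ℕ) : ℕ := rowHChunk (i / 64) / 2 ^ (25 * (i % 64)) % 2 ^ 25

/-- Representative pair of entry `(r, b)`. -/
def rowQH (r b : ℕ) : Fin 3158 := ⟨rowHE (1777 * r + b) % 2 ^ 14 % 3158, Nat.mod_lt _ (by decide)⟩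

/-- Transporting code of entry `(r, b)`. -/
def rowUH (r b : ℕ) : ℕ := rowHE (1777 * r + b) / 2 ^ 14 % 1024

/-- Transposition flag of entry `(r, b)`. -/
def rowSwH (r b : ℕ) : Bool := rowHE (1777 * r + b) / 2 ^ 24 % 2 == 1

/-- The transport claim for entry `(r, b)` of the H rows (total in `r`, `b`). -/
abbrev RowHOK (r b : ℕ) : Prop := rowUH r b < 768 ∧ 
  (if rowSwH r b then SymB4.gactT (rowUH r b) (S (pbH (rowQH r b).val)) = Sn (rowLineH r) ∧
      SymB4.gactT (rowUH r b) (S (paH (rowQH r b).val)) = Sn b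
    else SymB4.gactT (rowUH r b) (S (paH (rowQH r b).val)) = Sn (rowLineH r) ∧
      SymB4.gactT (rowUH r b) (S (pbH (rowQH r b).val)) = Sn b)

/-- Numeral `i` of the flat `rowR` table (dispatch over the data parts). -/
def rowRChunk (i : ℕ) : ℕ := if i < 345 then rowRChunkA (i - 0) else if i < 690 then rowRChunkB (i - 345) else if i < 1035 then rowRChunkC (i - 690) else rowRChunkD (i - 1035)

/-- Entry `i` of the flat `rowR` table (25 bits). -/
def rowRE (i : ℕ) : ℕ := rowRChunk (i / 64) / 2 ^ (25 * (i % 64)) % 2 ^ 25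

/-- Representative pair of entry `(r, b)`. -/
def rowQR (r b : ℕ) : Fin 8612 := ⟨rowRE (1147 * r + b) % 2 ^ 14 % 8612, Nat.mod_lt _ (by decide)⟩

/-- Transporting code of entry `(r, b)`. -/
def rowUR (r b : ℕ) : ℕ := rowRE (1147 * r + b) / 2 ^ 14 % 1024

/-- Transposition flag of entry `(r, b)`. -/
def rowSwR (r b : ℕ) : Bool := rowRE (1147 * r + b) / 2 ^ 24 % 2 == 1

/-- The transport claim for entry `(r, b)` of the R rows (total in `r`, `b`). -/
abbrev RowROK (r b : ℕ) : Prop := rowUR r b < 768 ∧ SymB4.smapT (rowUR r b) (.fwd 0) = .fwd 0 ∧ 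
  (if rowSwR r b then SymB4.gactT (rowUR r b) (R (pbR (rowQR r b).val)) = Rn (rowLineR r) ∧
      SymB4.gactT (rowUR r b) (R (paR (rowQR r b).val)) = Rn b
    else SymB4.gactT (rowUR r b) (R (paR (rowQR r b).val)) = Rn (rowLineR r) ∧
      SymB4.gactT (rowUR r b) (R (pbR (rowQR r b).val)) = Rn b)

/-- Class of the Hermitian row entry `(r, b)`. -/
def rowClsH (r b : ℕ) : Fin 10878 := clsH (rowQH r b).val

/-- Site class of the half-space row entry `(r, b)`. -/
def rowClsS (r b : ℕ) : Fin 10878 := clsS (rowQR r b).val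

/-- Link class of the half-space row entry `(r, b)`. -/
def rowClsL (r b : ℕ) : Fin 10878 := clsL (rowQR r b).val

end KZL2rpD4

end Summit.QuantumFields.GaugeBoot

end
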